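import Summits.NavierStokesRegularity.NavierStokesRegularity.Theorems.AdaptedFrequencyFrequencyRigidityFlatReduction
import Summits.NavierStokesRegularity.NavierStokesRegularity.Theorems.AdaptedFrequencyFrequencyRigidityFlatSelfSimilarLeaf
import Summits.NavierStokesRegularity.NavierStokesRegularity.Theorems.FrequencyRigidity.Negative.TwoEndedPinningStubs
import Summits.NavierStokesRegularity.NavierStokesRegularity.Theorems.FrequencyRigidity.Negative.RSSWall
import Summits.NavierStokesRegularity.NavierStokesRegularity.Theorems.AdaptedFrequencyAdaptedKernelExists
import Literature.Analysis.FluidPDE.AdaptedBackwardKernel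
import Literature.Analysis.FluidPDE.SelfSimilar
import HarnessLib

/-!
# Line `moving-adjoint-bernoulli` (v2, lead-1 reshape) — crux `AdaptedFrequency.FrequencyRigidity`
# (stmt-NavierStokesRegularity-2955)

Lead skeleton, 2026-08-16, `prover-line-stmt-NavierStokesRegularity-2955-1`.  It RESHAPES the planner's line
`Cruxes/FrequencyRigidity/Lines/moving-adjoint-bernoulli.lean` (six stubs S1–S6) on top of what has LANDED for
this crux since that skeleton was written:

* the FLAT REDUCTION `TwoEndedPinning.frequencyRigidity_of_flatEnstrophyLiouville` (p91321): the crux follows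
  from "no flat inhabitant" — no classical ancient Navier–Stokes flow on `ℝ³ × (−∞,0)` with the global
  Type-I bound, the scale-invariant derivative bounds, an adapted two-sided Gaussian-comparable kernel at
  `(0,0)` and the EXACT enstrophy law `H(t) = A(−t)^{−2}`, `A > 0`, with the transport-free first variation
  (`Negative.TwoEndedPinning.IsFlatInhabitant`, landed vocabulary); pinning (T) and the scale-invariant
  bounds are therefore no longer stubs of any line;
* the self-similar leaf `TwoEndedPinning.stub_flatEnstrophyLiouville_selfSimilar` (p87055, Tsai 1998 Thm 1);
* the disprover's WALL `Negative.rssLiouvilleBounded_of_frequencyRigidity` (p84263):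
  `CoRotatingKernelHypothesis α → FrequencyRigidity → RSSLiouvilleBounded α` for every `α`.

## Shape (seven registered stubs; `FrequencyRigidity_of` sorry-free outside `stub_*`)

A flat inhabitant `(ν, C, A, C', v, q, K)` is carried through:

* `stub_mildFrameBounds` (S1a, provable, XL — the KNSS NORMAL FORM every Liouville crux of the summit needs):
  a classical ancient flow with the global Type-I bound is, in the Galilean frame `a(t)` of its mild
  representative (`a(0⁻) = 0`, `‖a(t)‖ ≤ C₂√(−t)`), a classical Type-I flow `w = v(·+a) − a′` with a
  pressure `p` obeying the scale-invariant growth bounds `(−t)^{3/2}‖∂ₜw‖ + (−t)|p| + (−t)^{3/2}‖∇p‖ +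
  (−t)²|∂ₜp| ≤ M(1+‖x‖/√(−t))^N` (KNSS 2009 Lemma 3.1 + §4 (4.10)–(4.11), Duhamel from `t = −∞`).
* `stub_normalFormTransport` (S1b, provable, M–L — pure calculus): transporting the kernel along the same
  frame, `K′ = K(·+a)`, gives again a FLAT INHABITANT `(ν, C₂, A, C', w, p, K′)` (same `A`, same `C'`),
  now with the planner's full bound block (the bounds S2 needs).
* `stub_movingAdjointBernoulli` (S2, the planner's LEVER, verbatim): the kernel-paired head law
  `d/dt ∫(½|w|² + p)K = −νH + ∫(∂ₜp)K`.
* `stub_steadyKernelLeaf` (S3, NEW, provable, M–L): a normal-form flat inhabitant whose KERNEL is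
  self-similar, `K(t,x) = (−t)^{−3/2}𝒦(x/√(−t))`, is impossible: for such a kernel the kernel-paired Leray
  head `μ(s) = ∫(½|W|² + ½ y·W)𝒦 dy` (`W = √(−t) w`, `y = x/√(−t)`, `s = −log(−t)`) obeys `dμ/ds = −ν(−t)²H(t)`
  EXACTLY — the pressure pairs to `∫ p (∂ₜ + w·∇)K = −ν∫ p ΔK` against a self-similar adapted kernel and
  cancels against `−ν∫|∇w|²K` up to `−ν∫‖curl w‖²K` — so flatness `(−t)²H ≡ A > 0` contradicts the
  boundedness `|μ| ≤ ½C² + ½C·(Gaussian first moment)`.  This strictly contains the Tsai leaf (a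
  self-similar FLOW may be given a self-similar kernel) and removes the disprover's kinematic objects (C),
  (R) (steady Gaussian kernel) by the momentum equation, as exposure (C) demands.
* `stub_kernelCompactness` (S4, NEW, provable, L — THE ENGINE of the wall): adapted kernels of ONE smooth
  divergence-free locally bounded drift on growing windows `[−n−1, 0)`, squeezed between two fixed Gaussians,
  have a subsequence converging pointwise on `t < 0` to an adapted kernel on `(−∞,0)` between the same
  Gaussians (interior parabolic regularity for a fixed smooth linear equation + very weak limit +
  hypoellipticity: the mechanism of the landed `stub_kernelLimit` of crux AdaptedKernelExists).
* `ancientKernel_of_compactness` (PROVED here from S4 and the landed `linearTypeIDriftKernel` of the PROVED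
  crux AdaptedKernelExists, constants depending on `(ν, C)` only): EVERY Type-I smooth divergence-free drift on
  `(−∞,0)` carries an adapted Gaussian-comparable kernel at `(0,0)`.
* `stub_coRotatingKernel` (S5, NEW, provable, L): hence `∀ α, Negative.CoRotatingKernelHypothesis α` —
  push an ancient comparable kernel of an RSS drift forward under its screw-symmetry group (same constants),
  Cesàro-average over the group (still an adapted comparable kernel: the clauses are linear/convex), extract a
  limit by S4; the limit is invariant, i.e. CO-ROTATING.  With the landed wall this makes
  `FrequencyRigidity → ∀ α, RSSLiouvilleBounded α` UNCONDITIONAL (`rssLiouville_of_FrequencyRigidity` below):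
  the crux, and the terminal stub, PROVABLY contain Pineau–Vicol 2026 Conj. 1.1 (bounded-gradient class) for
  every rotation speed.
* `stub_flatRigidity` (S7, TERMINAL, held by the lead; OPEN): a normal-form flat inhabitant obeying the head
  law whose kernel is NOT self-similar and whose velocity is NOT backward self-similar does not exist.  By the
  composition it is equivalent to the crux given S1a–S3; by S4–S5 + RSSWall it contains bounded-gradient
  RSS-Liouville for every `α ≠ 0`.  (The planner's bet S4 `rotatingWaveReduction` + leaves S5/S6 are merged
  into it: the disprover's breathing swirl (R) shows that no kinematic/normal-form information forces a
  rotating wave, and no NS mechanism for it is in print.)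

Composition (`FrequencyRigidity_of`): crux ⇐ (flat reduction, landed) no flat inhabitant ⇐ S1a, S1b normal
form; case K′ self-similar: S3; case w self-similar: landed Tsai leaf; else S2 head law + S7.

Disproof used (`Cruxes/FrequencyRigidity/Disproof.lean` v6.3 @ tree, read 2026-08-16T10:20Z, NO KILL):
(A) `H > 0` enters as `A > 0` (S3's contradiction, S7's hypothesis); (B)/(B′) the GLOBAL Type-I bound is used by
S1a (KNSS on every slab, both ends; `‖a(t)‖ ≤ C₂√(−t)` at both ends), by S3 (boundedness of `μ` at BOTH ends of
`s`) and by S4/S5 (uniform Lyapunov/Gaussian constants); (C)/(R) the momentum equation enters at S2/S3 — the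
kinematic swirl and the breathing swirl have the steady Gaussian kernel and flat `H`, and S3 is exactly the stub
that removes them; (T) is imported through the flat reduction; (W) the wall is made unconditional by S4–S5;
Targets (v2): the planner's S1 is split (S1a analytic / S1b calculus) along the line the disprover's readback
draws (mild representative vs. transport), S2 kept verbatim ("TRUE technical lemma").  Negatives index:
stmt-4055 (Galilei parasitic modes) is why S1a fixes the frame; stmt-0154 unrelated.
-/

set_option linter.dupNamespace false
set_option linter.unusedVariables false

noncomputable section

namespace Summit.NavierStokesRegularity.NavierStokesRegularity.Cruxes.FrequencyRigidity.MovingAdjointBernoulli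

open MeasureTheory Set Filter Topology Function
open Literature.Analysis.FluidPDE
open Summit.NavierStokesRegularity.NavierStokesRegularity.Theorems
open Summit.NavierStokesRegularity.NavierStokesRegularity.Theorems.FrequencyRigidity
open Summit.NavierStokesRegularity.NavierStokesRegularity.Theorems.FrequencyRigidity.Negative.TwoEndedPinning
  (IsFlatInhabitant ScaleInvariantBounds firstVariationDensity)

local notation "ℝ³" => EuclideanSpace ℝ (Fin 3)

/-! ## Readable aliases (definitionally the blocks inlined in the stub signatures) -/

/-- The planner's NORMAL-FORM BOUND BLOCK (verbatim from the line skeleton's `ScaleInvariantBounds M N w π`):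
vorticity bound `(−t)‖curl w‖ ≤ M` and polynomial-in-`|x|/√(−t)` growth of the scale-invariant sizes of
`w, ∇w, ∇²w, ∂ₜw, π, ∇π, ∂ₜπ`. -/
def NFBounds (M : ℝ) (N : ℕ) (w : ℝ → ℝ³ → ℝ³) (π : ℝ → ℝ³ → ℝ) : Prop :=
  (∀ t < 0, ∀ x,
    ‖Literature.Analysis.FluidPDE.curl (w t) x‖ ≤ M / (-t) ∧
    Real.sqrt (-t) * ‖w t x‖ + (-t) * ‖fderiv ℝ (w t) x‖ +
        (-t) * Real.sqrt (-t) * (‖iteratedFDeriv ℝ 2 (w t) x‖ +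
          ‖Literature.Analysis.FluidPDE.timeDerivWithin (Set.Iio 0) w t x‖) +
        (-t) * |π t x| + (-t) * Real.sqrt (-t) * ‖fderiv ℝ (π t) x‖ +
        (-t) ^ 2 * |Literature.Analysis.FluidPDE.timeDerivWithin (Set.Iio 0) π t x|
      ≤ M * (1 + ‖x‖ / Real.sqrt (-t)) ^ N)

/-- SELF-SIMILAR KERNEL about the pole: `K(t,x) = (−t)^{−3/2} 𝒦(x/√(−t))` for `t < 0`. -/
def IsSelfSimilarKernel (K : ℝ → ℝ³ → ℝ) : Prop :=
  (∃ 𝒦 : EuclideanSpace ℝ (Fin 3) → ℝ, ∀ t < 0, ∀ x, K t x = (Real.sqrt (-t))⁻¹ ^ 3 * 𝒦 ((Real.sqrt (-t))⁻¹ • x))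

/-- Backward SELF-SIMILAR VELOCITY about the pole (Leray's ansatz, `a = ½`, `T = 0`): the shape the landed
Tsai leaf consumes. -/
def IsSelfSimilarVelocity (w : ℝ → ℝ³ → ℝ³) : Prop :=
  (∃ U : EuclideanSpace ℝ (Fin 3) → EuclideanSpace ℝ (Fin 3), ∀ t < 0, w t = Literature.Analysis.FluidPDE.lerayBackward (1 / 2) 0 U t)

/-- The HEAD LAW for `(w, π, K)` (conclusion of S2, verbatim). -/
def HeadLaw (ν : ℝ) (w : ℝ → ℝ³ → ℝ³) (π : ℝ → ℝ³ → ℝ) (K : ℝ → ℝ³ → ℝ) : Prop :=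
  (∀ t < 0, HasDerivAt (fun τ => ∫ x, (2⁻¹ * ‖w τ x‖ ^ 2 + π τ x) * K τ x)
        (-ν * Literature.Analysis.FluidPDE.adaptedEnstrophy w K t +
          ∫ x, Literature.Analysis.FluidPDE.timeDerivWithin (Set.Iio 0) π t x * K t x) t)

/-- KERNEL COMPACTNESS (statement of S4). -/
def KernelCompactness : Prop :=
  ∀ (ν c₁ c₂ C₁ C₂ : ℝ) (v : ℝ → EuclideanSpace ℝ (Fin 3) → EuclideanSpace ℝ (Fin 3)) (K : ℕ → ℝ → EuclideanSpace ℝ (Fin 3) → ℝ),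
      0 < ν → 0 < c₁ → 0 < c₂ → 0 < C₁ → 0 < C₂ →
      Literature.Analysis.FluidPDE.IsSmoothSpaceTimeOn (Set.Iio 0) v →
      (∀ t ∈ Set.Iio (0:ℝ), Literature.Analysis.FluidPDE.VectorCalculus.IsDivFree (v t)) →
      (∀ a b : ℝ, a < b → b < 0 → ∃ B : ℝ, ∀ t ∈ Set.Icc a b, ∀ x, ‖v t x‖ ≤ B) →
      (∀ n : ℕ, Literature.Analysis.FluidPDE.IsAdaptedBackwardKernel ν v (Set.Ico (-(n:ℝ) - 1) 0) 0 0 (K n) ∧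
        ∀ t ∈ Set.Ico (-(n:ℝ) - 1) (0:ℝ), ∀ x,
          c₁ * ((0:ℝ) - t) ^ (-(3:ℝ) / 2) * Real.exp (-(‖x - (0 : EuclideanSpace ℝ (Fin 3))‖ ^ 2) / (c₂ * ((0:ℝ) - t))) ≤ K n t x ∧
          K n t x ≤ C₁ * ((0:ℝ) - t) ^ (-(3:ℝ) / 2) * Real.exp (-(‖x - (0 : EuclideanSpace ℝ (Fin 3))‖ ^ 2) / (C₂ * ((0:ℝ) - t)))) →
      ∃ (G : ℝ → EuclideanSpace ℝ (Fin 3) → ℝ) (φ : ℕ → ℕ), StrictMono φ ∧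
        Literature.Analysis.FluidPDE.IsAdaptedBackwardKernel ν v (Set.Iio 0) 0 0 G ∧
        (∀ t ∈ Set.Iio (0:ℝ), ∀ x,
          c₁ * ((0:ℝ) - t) ^ (-(3:ℝ) / 2) * Real.exp (-(‖x - (0 : EuclideanSpace ℝ (Fin 3))‖ ^ 2) / (c₂ * ((0:ℝ) - t))) ≤ G t x ∧
          G t x ≤ C₁ * ((0:ℝ) - t) ^ (-(3:ℝ) / 2) * Real.exp (-(‖x - (0 : EuclideanSpace ℝ (Fin 3))‖ ^ 2) / (C₂ * ((0:ℝ) - t)))) ∧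
        (∀ t ∈ Set.Iio (0:ℝ), ∀ x,
          Filter.Tendsto (fun n => K (φ n) t x) Filter.atTop (nhds (G t x)))

/-- ANCIENT KERNEL EXISTENCE with constants depending on `(ν, C)` only (proved below from S4). -/
def AncientKernel : Prop :=
  ∀ (ν C : ℝ), 0 < ν → 0 ≤ C → ∃ c₁ c₂ C₁ C₂ : ℝ, 0 < c₁ ∧ 0 < c₂ ∧ 0 < C₁ ∧ 0 < C₂ ∧
      ∀ (v : ℝ → EuclideanSpace ℝ (Fin 3) → EuclideanSpace ℝ (Fin 3)),
        Literature.Analysis.FluidPDE.IsSmoothSpaceTimeOn (Set.Iio 0) v →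
        (∀ t ∈ Set.Iio (0:ℝ), Literature.Analysis.FluidPDE.VectorCalculus.IsDivFree (v t)) →
        Literature.Analysis.FluidPDE.HasTypeITimeDecay C v →
        ∃ G : ℝ → EuclideanSpace ℝ (Fin 3) → ℝ, Literature.Analysis.FluidPDE.IsAdaptedBackwardKernel ν v (Set.Iio 0) 0 0 G ∧
          ∀ t ∈ Set.Iio (0:ℝ), ∀ x,
            c₁ * ((0:ℝ) - t) ^ (-(3:ℝ) / 2) * Real.exp (-(‖x - (0 : EuclideanSpace ℝ (Fin 3))‖ ^ 2) / (c₂ * ((0:ℝ) - t))) ≤ G t x ∧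
            G t x ≤ C₁ * ((0:ℝ) - t) ^ (-(3:ℝ) / 2) * Real.exp (-(‖x - (0 : EuclideanSpace ℝ (Fin 3))‖ ^ 2) / (C₂ * ((0:ℝ) - t)))

/-! ## Registered stubs (signatures over tree declarations only; the ONLY `sorry`s of the file) -/

/-- **S1a `stub_mildFrameBounds` (provable, XL) — the KNSS normal form: mild frame + scale-invariant
pressure/time-derivative bounds.**  For a classical Navier–Stokes flow `(v, q)` on `ℝ³ × (−∞,0)` with the
GLOBAL Type-I bound `‖v(t,x)‖ ≤ C/√(−t)` there are a smooth frame `a : (−∞,0) → ℝ³` with `‖a(t)‖ ≤ C₂√(−t)`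
(both ends!) and a pressure `p` such that the Galilei transform `w(t,x) = v(t, x + a(t)) − a′(t)` is again a
classical Type-I flow (constant `C₂`) with pressure `p`, and `(−t)^{3/2}‖∂ₜw‖ + (−t)|p| + (−t)^{3/2}‖∇p‖ +
(−t)²|∂ₜp| ≤ M(1 + ‖x‖/√(−t))^N`.
Why true: `u(t) := −∫_{−∞}^t e^{ν(t−s)Δ} P∇·(v⊗v)(s) ds` converges for a Type-I field
(`∫_{−∞}^t (t−s)^{−1/2}(−s)^{−1} ds = π(−t)^{−1/2}`) and is Type-I; `z := v − u` is a bounded (on every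
`(−∞,t₀]`) weak solution of the homogeneous Stokes system, hence `z = (caloric) + b(t)` by KNSS Lemma 3.1
(tree: `KNSS2009_lemma31_homogeneous`, `exists_caloric_decomposition_of_twoTime`, `KNSSLemma31*`), and a bounded
ancient caloric field that tends to `0` at `t → −∞` (as `z` does) is `0`; so `v = u + b(t)` with `u`
drift-mild, `|b| ≤ |v| + |u| ≲ (−t)^{−1/2}`; the Galilei frame `a′ = b`, `a(0⁻) = 0` (so
`‖a(t)‖ ≤ 2C₂√(−t)`) makes `w` genuinely mild (`IsKNSSDriftMild.GalileanCovariance`, tree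
`KNSSRegularityGalilean(Proofs)`), `w ∈ IsTypeIAncientMild`; KNSS §4 smoothing in scale-invariant form on
dyadic windows (tree `KNSS2009_mild_regularity` / `KNSS2009_driftMild_regularity` /
`KNSS2009_regularity_boundedWeak_window_holds`, (4.10)–(4.11): `‖∇ᵏw‖ ≲ (−t)^{−(k+1)/2}`,
`‖∇ᵏ∂ₜw‖ ≲ (−t)^{−(k+3)/2}`) bounds `∂ₜw`, hence `∇p = νΔw − ∂ₜw − (w·∇)w` and `∇∂ₜp`; the gauge
`p(t,0) = 0` gives `|p| ≤ ‖x‖ sup‖∇p‖`, `|∂ₜp| ≤ ‖x‖ sup‖∇∂ₜp‖` (`N = 1`); `p` is a classical pressure for `w`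
on `(−∞,0)` (tree `IsTypeIAncientMild.exists_isClassicalNSSolutionOn_Ioo` gives one on every window; two
pressures of the same smooth flow differ by a function of `t`, fixed by the gauge).  Uses: momentum equation,
GLOBAL Type-I (both ends), `div v = 0`.  Leans on: KochNadirashviliSereginSverak2009 §3 Lemma 3.1, §4
(arXiv:0709.3599); tree `KNSSWeakDriftMild`, `KNSSLemma31Assembly`, `KNSSRegularityGalilean`,
`KNSSRegularityDecomposition`, `TypeIAncientMild(Classical)`, `ClassicalBoundedWeak`
(`IsClassicalNSSolutionOn.isBoundedWeakNSSolutionOn`), `OseenHeat*`. -/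
theorem stub_mildFrameBounds :
    ∀ (ν C : ℝ) (v : ℝ → EuclideanSpace ℝ (Fin 3) → EuclideanSpace ℝ (Fin 3)) (q : ℝ → EuclideanSpace ℝ (Fin 3) → ℝ), 0 < ν →
      Literature.Analysis.FluidPDE.IsClassicalNSSolutionOn (Set.Iio 0) ν 0 v q → Literature.Analysis.FluidPDE.HasTypeITimeDecay C v →
      ∃ (C₂ M : ℝ) (N : ℕ) (a : ℝ → EuclideanSpace ℝ (Fin 3)) (p : ℝ → EuclideanSpace ℝ (Fin 3) → ℝ),
        ContDiffOn ℝ (⊤ : ℕ∞) a (Set.Iio 0) ∧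
        (∀ t < 0, ‖a t‖ ≤ C₂ * Real.sqrt (-t)) ∧
        Literature.Analysis.FluidPDE.IsClassicalNSSolutionOn (Set.Iio 0) ν 0 (fun t x => v t (x + a t) - deriv a t) p ∧
        Literature.Analysis.FluidPDE.HasTypeITimeDecay C₂ (fun t x => v t (x + a t) - deriv a t) ∧
        (∀ t < 0, ∀ x,
          (-t) * Real.sqrt (-t) *
              ‖Literature.Analysis.FluidPDE.timeDerivWithin (Set.Iio 0) (fun t x => v t (x + a t) - deriv a t) t x‖ +
            (-t) * |p t x| + (-t) * Real.sqrt (-t) * ‖fderiv ℝ (p t) x‖ +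
            (-t) ^ 2 * |Literature.Analysis.FluidPDE.timeDerivWithin (Set.Iio 0) p t x|
          ≤ M * (1 + ‖x‖ / Real.sqrt (-t)) ^ N) := by
  sorry

/-- **S1b `stub_normalFormTransport` (provable, M–L) — transporting a flat inhabitant along the mild frame.**
If `(ν, C, A, C', v, q, K)` is a flat inhabitant and `(a, p, C₂, M, N)` is a frame as produced by S1a for
`(v, q)`, then with `w(t,x) = v(t, x + a(t)) − a′(t)` and `K′(t,x) = K(t, x + a(t))` the tuple
`(ν, C₂, A, C', w, p, K′)` is again a flat inhabitant (same `A`: vorticity and the kernel are translated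
together; same `C'`: spatial derivatives of order `≥ 1` are blind to `x`-translations and to `−a′(t)`), and the
full normal-form bound block holds for `(w, p)` with some `(M′, N′)`.
Why true (calculus): adjoint clause `∂ₜK′ + w·∇K′ + νΔK′ = (∂ₜK + a′·∇K + (v − a′)·∇K + νΔK)(·+a) = 0`
(chain rule in `t` within `Iio 0`, `a` differentiable there); positivity, `C²`, unit mass are
translation-invariant; concentration at `0`: `∫φ K′(t) = ∫φ(· − a(t))K(t) → φ(0)` because `a(t) → 0`
(`‖a(t)‖ ≤ C₂√(−t)`), `φ` is uniformly continuous on balls and `K(t)` has Gaussian tails; comparability with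
constants `(c₁e^{−2C₂²/c₂}, c₂/2, C₁e^{2C₂²/C₂}, 2C₂)` from `½‖x‖² − C₂²(−t) ≤ ‖x + a‖² ≤ 2‖x‖² + 2C₂²(−t)`;
`adaptedEnstrophy w K′ = adaptedEnstrophy v K` as functions and the first-variation integrand translates
(`integral_add_right_eq_self`), so clauses (viii)–(ix) transfer verbatim; the bound block: `‖curl w‖ ≤
‖curlCLM‖·C'₁/(−t)`, `√(−t)‖w‖ ≤ C₂`, `(−t)‖∇w‖ ≤ C'₁`, `(−t)^{3/2}‖∇²w‖ ≤ C'₂`, plus S1a's block, all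
`≤ M′(1 + ‖x‖/√(−t))^{N}` with `M′ = ‖curlCLM‖C'₁ + C₂ + C'₁ + C'₂ + M`.  Leans on: Mathlib
`iteratedFDeriv_comp_add_right`, `fderiv_comp_add_right`, `integral_add_right_eq_self`,
`derivWithin` chain rule (`HasDerivWithinAt.scomp`/`hasDerivAt_timeLine` pattern), tree
`IsAdaptedBackwardKernel`, `isGaussianComparable_iff_fin_three`, `KNSSRegularityGalilean`
(`fderiv_comp_sub_right`, `laplacian_comp_sub_right`). -/
theorem stub_normalFormTransport :
    ∀ (ν C A C₂ M : ℝ) (N : ℕ) (C' : ℕ → ℝ) (v : ℝ → EuclideanSpace ℝ (Fin 3) → EuclideanSpace ℝ (Fin 3)) (q : ℝ → EuclideanSpace ℝ (Fin 3) → ℝ)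
      (K : ℝ → EuclideanSpace ℝ (Fin 3) → ℝ) (a : ℝ → EuclideanSpace ℝ (Fin 3)) (p : ℝ → EuclideanSpace ℝ (Fin 3) → ℝ),
      Summit.NavierStokesRegularity.NavierStokesRegularity.Theorems.FrequencyRigidity.Negative.TwoEndedPinning.IsFlatInhabitant ν C A C' v q K →
      (ContDiffOn ℝ (⊤ : ℕ∞) a (Set.Iio 0) ∧
        (∀ t < 0, ‖a t‖ ≤ C₂ * Real.sqrt (-t)) ∧
        Literature.Analysis.FluidPDE.IsClassicalNSSolutionOn (Set.Iio 0) ν 0 (fun t x => v t (x + a t) - deriv a t) p ∧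
        Literature.Analysis.FluidPDE.HasTypeITimeDecay C₂ (fun t x => v t (x + a t) - deriv a t) ∧
        (∀ t < 0, ∀ x,
          (-t) * Real.sqrt (-t) *
              ‖Literature.Analysis.FluidPDE.timeDerivWithin (Set.Iio 0) (fun t x => v t (x + a t) - deriv a t) t x‖ +
            (-t) * |p t x| + (-t) * Real.sqrt (-t) * ‖fderiv ℝ (p t) x‖ +
            (-t) ^ 2 * |Literature.Analysis.FluidPDE.timeDerivWithin (Set.Iio 0) p t x|
          ≤ M * (1 + ‖x‖ / Real.sqrt (-t)) ^ N)) →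
      ∃ (M' : ℝ) (N' : ℕ),
        Summit.NavierStokesRegularity.NavierStokesRegularity.Theorems.FrequencyRigidity.Negative.TwoEndedPinning.IsFlatInhabitant ν C₂ A C'
          (fun t x => v t (x + a t) - deriv a t) p (fun t x => K t (x + a t)) ∧
        (∀ t < 0, ∀ x,
          ‖Literature.Analysis.FluidPDE.curl ((fun t x => v t (x + a t) - deriv a t) t) x‖ ≤ M' / (-t) ∧
          Real.sqrt (-t) * ‖(fun t x => v t (x + a t) - deriv a t) t x‖ + (-t) * ‖fderiv ℝ ((fun t x => v t (x + a t) - deriv a t) t) x‖ +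
              (-t) * Real.sqrt (-t) * (‖iteratedFDeriv ℝ 2 ((fun t x => v t (x + a t) - deriv a t) t) x‖ +
                ‖Literature.Analysis.FluidPDE.timeDerivWithin (Set.Iio 0) (fun t x => v t (x + a t) - deriv a t) t x‖) +
              (-t) * |p t x| + (-t) * Real.sqrt (-t) * ‖fderiv ℝ (p t) x‖ +
              (-t) ^ 2 * |Literature.Analysis.FluidPDE.timeDerivWithin (Set.Iio 0) p t x|
            ≤ M' * (1 + ‖x‖ / Real.sqrt (-t)) ^ N') := by
  sorry

/-- **S2 `stub_movingAdjointBernoulli` (the planner's stub, VERBATIM; provable, M–L) — THE LEVER.**  For a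
classical Navier–Stokes pair `(w, π)` on `(−∞,0)`, an adapted Gaussian-comparable kernel `K` at `(0,0)` and the
normal-form bound block, the kernel-mean head `∫(½|w|² + π)K` is differentiable with
`d/dt ∫(½|w|²+π)K = −ν ∫|curl w|²K + ∫(∂ₜπ)K`.  Pointwise: `(∂ₜ + w·∇ − νΔ)(½|w|² + π) = ∂ₜπ − ν|curl w|²`
(momentum equation dotted with `w`; `Δπ = −tr((∇w)²) = ½|curl w|² − |S|²`, `|∇w|² = |S|² + ½|curl w|²`);
pairing: `d/dt ∫ f K = ∫ (∂ₜf + w·∇f − νΔf) K` for densities of polynomial growth, by the adjoint clause and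
whole-space integration by parts through cut-offs `χ_R` (the landed `TwoEndedPinning.stub_kernelPairing`,
p86161, with its lemmas p84385, is exactly this engine: check its hypotheses `hφ`, `hbd` for
`φ = ½|w|² + π`).  Sources: Tsai1998 (1.7); NecasRuzickaSverak1996 §3; PineauVicol2026 (7.7); Friedman1964
Ch. 1 §8; tree `AdaptedFrequencyFrequencyRigidityKernelPairing(Lemmas)`, `WholeSpaceIBP`. -/
theorem stub_movingAdjointBernoulli :
    ∀ (ν M : ℝ) (N : ℕ) (w : ℝ → EuclideanSpace ℝ (Fin 3) → EuclideanSpace ℝ (Fin 3))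
      (π : ℝ → EuclideanSpace ℝ (Fin 3) → ℝ) (K : ℝ → EuclideanSpace ℝ (Fin 3) → ℝ), 0 < ν →
      Literature.Analysis.FluidPDE.IsClassicalNSSolutionOn (Set.Iio 0) ν 0 w π →
      Literature.Analysis.FluidPDE.IsAdaptedBackwardKernel ν w (Set.Iio 0) 0 0 K →
      Literature.Analysis.FluidPDE.IsGaussianComparable K (Set.Iio 0) 0 0 →
      (∀ t < 0, ∀ x,
        ‖Literature.Analysis.FluidPDE.curl (w t) x‖ ≤ M / (-t) ∧
        Real.sqrt (-t) * ‖w t x‖ + (-t) * ‖fderiv ℝ (w t) x‖ +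
            (-t) * Real.sqrt (-t) * (‖iteratedFDeriv ℝ 2 (w t) x‖ +
              ‖Literature.Analysis.FluidPDE.timeDerivWithin (Set.Iio 0) w t x‖) +
            (-t) * |π t x| + (-t) * Real.sqrt (-t) * ‖fderiv ℝ (π t) x‖ +
            (-t) ^ 2 * |Literature.Analysis.FluidPDE.timeDerivWithin (Set.Iio 0) π t x|
          ≤ M * (1 + ‖x‖ / Real.sqrt (-t)) ^ N) →
      (∀ t < 0, HasDerivAt (fun τ => ∫ x, (2⁻¹ * ‖w τ x‖ ^ 2 + π τ x) * K τ x)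
        (-ν * Literature.Analysis.FluidPDE.adaptedEnstrophy w K t +
          ∫ x, Literature.Analysis.FluidPDE.timeDerivWithin (Set.Iio 0) π t x * K t x) t) := by
  sorry

/-- **S3 `stub_steadyKernelLeaf` (NEW; provable, M–L) — no normal-form flat inhabitant with a SELF-SIMILAR
kernel.**  Let `(ν, C, A, C', w, π, K)` be a flat inhabitant with the normal-form bound block and
`K(t,x) = (−t)^{−3/2}𝒦(x/√(−t))`.  Put `h(t) = 1/(2(−t))`, `f(t,x) = ½‖w‖² + h(t)⟪x, w⟫` and
`m(t) = ∫ f(t,·)K(t,·)`.  Kernel pairing (as in S2) gives `m′ = ∫(∂ₜ + w·∇ − νΔ)f · K` with, by the momentum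
equation, `(∂ₜ+w·∇−νΔ)f = −⟪w + h x, ∇π⟫ − ν|∇w|² + h′⟪x,w⟫ + h‖w‖²`; the pressure term integrates by parts to
`∫ π div((w + hx)K) = ∫ π (w·∇K + h x·∇K + 3hK) = ∫ π (w·∇K + ∂ₜK)` BECAUSE `K` IS SELF-SIMILAR
(`∂ₜK = (1/(−t))(³⁄₂K + ½x·∇K)`), `= −ν∫ π ΔK = −ν ∫ (Δπ) K = −ν∫(½‖curl w‖² − |S|²)K`, while
`−ν∫|∇w|²K = −ν∫(|S|² + ½‖curl w‖²)K`; so `m′(t) = −νH(t) + m(t)/(−t)`, i.e. `d/dt[(−t)m(t)] = −ν(−t)H(t)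
= −νA/(−t)` by flatness.  But `(−t)|m(t)| ≤ ½C² + ½C·C₁∫‖y‖e^{−‖y‖²/C₂}dy =: B` for all `t < 0` (Type-I
bound + Gaussian upper bound + unit mass), and a function on `(−∞,0)` with derivative `−νA/(−t)`, `νA > 0`,
is `−νA·log` up to a constant — unbounded at BOTH ends.  Contradiction.  (All pairings are legal by the bound
block: `f`, `∂ₜf`, `∇f`, `Δf`, `π`, `∇π` grow polynomially in `‖x‖/√(−t)` at each fixed `t`, `K` has Gaussian
tails; use the landed pairing engine p86161/p84385 with `φ = f`, or redo its cut-off argument.)  Uses: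
momentum equation (through `∇π` and `Δπ = ½|ω|² − |S|²`), `div w = 0`, self-similarity of `K` (exactly once),
GLOBAL Type-I (boundedness of `(−t)m` at both ends), `A > 0`.  Leans on: tree
`TwoEndedPinning.stub_kernelPairing` (+ `KernelPairingLemmas`), `IsClassicalNSSolutionOn.momentum`,
`WholeSpaceIBP`, `norm_curl_sq_eq_sum`-type identities (`VectorCalculus`), Mathlib `integral_mul_left`,
`HasDerivAt.mul`, `Real.log` calculus (`Real.hasDerivAt_log`), `image_le_of_deriv`-type monotonicity. -/
theorem stub_steadyKernelLeaf :
    ∀ (ν C A M : ℝ) (N : ℕ) (C' : ℕ → ℝ) (w : ℝ → EuclideanSpace ℝ (Fin 3) → EuclideanSpace ℝ (Fin 3)) (π : ℝ → EuclideanSpace ℝ (Fin 3) → ℝ)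
      (K : ℝ → EuclideanSpace ℝ (Fin 3) → ℝ),
      Summit.NavierStokesRegularity.NavierStokesRegularity.Theorems.FrequencyRigidity.Negative.TwoEndedPinning.IsFlatInhabitant ν C A C' w π K →
      (∀ t < 0, ∀ x,
        ‖Literature.Analysis.FluidPDE.curl (w t) x‖ ≤ M / (-t) ∧
        Real.sqrt (-t) * ‖w t x‖ + (-t) * ‖fderiv ℝ (w t) x‖ +
            (-t) * Real.sqrt (-t) * (‖iteratedFDeriv ℝ 2 (w t) x‖ +
              ‖Literature.Analysis.FluidPDE.timeDerivWithin (Set.Iio 0) w t x‖) +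
            (-t) * |π t x| + (-t) * Real.sqrt (-t) * ‖fderiv ℝ (π t) x‖ +
            (-t) ^ 2 * |Literature.Analysis.FluidPDE.timeDerivWithin (Set.Iio 0) π t x|
          ≤ M * (1 + ‖x‖ / Real.sqrt (-t)) ^ N) →
      (∃ 𝒦 : EuclideanSpace ℝ (Fin 3) → ℝ, ∀ t < 0, ∀ x, K t x = (Real.sqrt (-t))⁻¹ ^ 3 * 𝒦 ((Real.sqrt (-t))⁻¹ • x)) →
      False := by
  sorry

/-- **S4 `stub_kernelCompactness` (NEW; provable, L) — THE ENGINE: adapted kernels of one drift between two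
fixed Gaussians are compact.**  Let `v` be a jointly smooth, divergence-free drift on `(−∞,0) × ℝ³`, bounded on
every compact time window, and let `Kₙ` be adapted kernels of `∂ₜ + v·∇ − νΔ` on the windows `[−n−1, 0)` with
pole `(0,0)`, all squeezed between the SAME two Gaussians.  Then a subsequence converges pointwise on `t < 0`
to an adapted kernel `G` on `(−∞,0)` with pole `(0,0)` between the same Gaussians.
Why true: on each compact `[a,b] × B̄_R ⊂ (−∞,0) × ℝ³` the `Kₙ` (`n ≥ −a`) solve ONE linear parabolic equation
with smooth bounded coefficients and are uniformly bounded (Gaussian upper bound), so interior estimates bound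
all their derivatives uniformly (`C^{2+β,1+β/2}` Schauder, or: uniform `L²` bounds ⇒ very weak subsequential
limit ⇒ the limit is a very weak solution ⇒ smooth by Hörmander hypoellipticity for `∂ₜ + v·∇ + νΔ`, and
equicontinuity from the uniform bounds upgrades weak to locally uniform convergence — EXACTLY the mechanism of
the landed `AdaptedKernelExists.NashEntropyLastBlock.stub_kernelLimit` / `kernelLimit_of_hypoelliptic`, whose
lemmas (`KernelLimitExtract`, `…VeryWeakLimit`, `…Weak`, `…Concentration`, `stub_hypoelliptic`) should be reused,
not rebuilt); Arzelà–Ascoli + a diagonal argument over an exhaustion give `φ` and a `C²` limit `G` solving the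
adjoint equation classically; positivity: `G ≥` the lower Gaussian `> 0`; unit mass and the two-sided bounds
pass to pointwise limits by dominated convergence (Gaussian majorant); concentration at `0` as `t ↑ 0` follows
from the Gaussian UPPER bound at scale `√(−t)` + unit mass alone (`kernelLimit_concentration`, landed).  Uses:
smoothness and local boundedness of the drift only (no NS, no Type-I).  Leans on: tree
`AdaptedFrequencyAdaptedKernelExistsKernelLimit*` (eight landed files), `stub_hypoelliptic`
(`AdaptedFrequencyAdaptedKernelExistsHypoelliptic*`), `IsAdaptedBackwardKernel.mono`; Friedman1964 Ch. 3 §2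
(interior Schauder), LadyzhenskayaSolonnikovUraltseva1968 IV §10; Mathlib `ArzelaAscoli`
(`BoundedContinuousFunction.arzela_ascoli`), `TendstoLocallyUniformlyOn`, `tendsto_integral_of_dominated_convergence`. -/
theorem stub_kernelCompactness :
    ∀ (ν c₁ c₂ C₁ C₂ : ℝ) (v : ℝ → EuclideanSpace ℝ (Fin 3) → EuclideanSpace ℝ (Fin 3)) (K : ℕ → ℝ → EuclideanSpace ℝ (Fin 3) → ℝ),
      0 < ν → 0 < c₁ → 0 < c₂ → 0 < C₁ → 0 < C₂ →
      Literature.Analysis.FluidPDE.IsSmoothSpaceTimeOn (Set.Iio 0) v →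
      (∀ t ∈ Set.Iio (0:ℝ), Literature.Analysis.FluidPDE.VectorCalculus.IsDivFree (v t)) →
      (∀ a b : ℝ, a < b → b < 0 → ∃ B : ℝ, ∀ t ∈ Set.Icc a b, ∀ x, ‖v t x‖ ≤ B) →
      (∀ n : ℕ, Literature.Analysis.FluidPDE.IsAdaptedBackwardKernel ν v (Set.Ico (-(n:ℝ) - 1) 0) 0 0 (K n) ∧
        ∀ t ∈ Set.Ico (-(n:ℝ) - 1) (0:ℝ), ∀ x,
          c₁ * ((0:ℝ) - t) ^ (-(3:ℝ) / 2) * Real.exp (-(‖x - (0 : EuclideanSpace ℝ (Fin 3))‖ ^ 2) / (c₂ * ((0:ℝ) - t))) ≤ K n t x ∧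
          K n t x ≤ C₁ * ((0:ℝ) - t) ^ (-(3:ℝ) / 2) * Real.exp (-(‖x - (0 : EuclideanSpace ℝ (Fin 3))‖ ^ 2) / (C₂ * ((0:ℝ) - t)))) →
      ∃ (G : ℝ → EuclideanSpace ℝ (Fin 3) → ℝ) (φ : ℕ → ℕ), StrictMono φ ∧
        Literature.Analysis.FluidPDE.IsAdaptedBackwardKernel ν v (Set.Iio 0) 0 0 G ∧
        (∀ t ∈ Set.Iio (0:ℝ), ∀ x,
          c₁ * ((0:ℝ) - t) ^ (-(3:ℝ) / 2) * Real.exp (-(‖x - (0 : EuclideanSpace ℝ (Fin 3))‖ ^ 2) / (c₂ * ((0:ℝ) - t))) ≤ G t x ∧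
          G t x ≤ C₁ * ((0:ℝ) - t) ^ (-(3:ℝ) / 2) * Real.exp (-(‖x - (0 : EuclideanSpace ℝ (Fin 3))‖ ^ 2) / (C₂ * ((0:ℝ) - t)))) ∧
        (∀ t ∈ Set.Iio (0:ℝ), ∀ x,
          Filter.Tendsto (fun n => K (φ n) t x) Filter.atTop (nhds (G t x))) := by
  sorry

/-- **S5 `stub_coRotatingKernel` (NEW; provable, L) — co-rotating kernels for RSS drifts: the disprover's
hypothesis H(α) of the wall, for EVERY `α`.**  Given kernel compactness (S4) and ancient kernel existence
(`AncientKernel`, proved below from S4), every smooth bounded-gradient profile `U` whose RSS field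
`Negative.rss α U` (= `pvAnsatz α U`) is a classical Navier–Stokes flow on `(−∞,0)` (viscosity `1`) admits an
adapted Gaussian-comparable kernel at `(0,0)` of CO-ROTATING self-similar form (`Negative.IsCoRotating α`).
Why true: `v := rss α U` is jointly smooth on `(−∞,0) × ℝ³`, divergence-free (field of the classical-solution
hypothesis) and Type-I with `C = sup‖U‖` (`Negative.typeIBound_rss`), so `AncientKernel` gives a comparable
adapted kernel `K` on `(−∞,0)`.  The flow is invariant under the screw group `g_c : (t,x) ↦ (c²t, c R_c x)`,
`R_c = rotZ(2α log c)`, `c > 0` (`c R_c⁻¹ v(c²t, cR_c x) = v(t,x)`: unfold `rss`/`pvAnsatz`, `log(−c²t) =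
2log c + log(−t)`), and the push-forward `(g_c K)(t,x) = c³K(c²t, cR_c x)` is again adapted to `v` with the
SAME Gaussian constants (chain rules: `∂ₜ(g_cK) = c⁵(∂ₜK)∘g_c`, `∇(g_cK)·v = c⁴(∇K)∘g_c·(R_c v) =
c⁵((∇K)·v)∘g_c` by the symmetry, `Δ(g_cK) = c⁵(ΔK)∘g_c` since `R_c` is an isometry; unit mass / concentration
by the substitution `y = cR_c x`, Jacobian `c³`; `‖cR_c x‖²/(C₂c²(−t)) = ‖x‖²/(C₂(−t))`).  The Cesàro
averages `A_m K := m⁻¹∫₀^m g_{e^σ}K dσ` are adapted kernels between the same Gaussians (the five clauses and the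
bounds are linear/convex; `C²` and the adjoint clause by differentiation under the `σ`-integral, the integrand
being jointly smooth in `(σ,t,x)` with locally uniform bounds).  Apply S4 to `n ↦ A_{n+1}K` (restricted to the
windows): a subsequence converges pointwise to an adapted comparable `G`; and `G` is `g`-INVARIANT:
`|g_{e^τ}A_mK − A_mK|(t,x) ≤ (2τ/m)·C₁(−t)^{−3/2} → 0`, while `g_{e^τ}` acts pointwise, so
`g_{e^τ}G = lim g_{e^τ}A_{φ n}K = lim A_{φ n}K = G` for every `τ`, which is `IsCoRotating α G` (take `c = sc t =
(−t)^{−1/2}`: `G(t,x) = sc³ G(−1, R x/√(−t))` with `R = rotZ(−rotAngle α t)`).  Uses: smoothness, `div = 0`,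
Type-I of the RSS drift; NOT the momentum equation (only its `divFree` field).  Leans on: S4 (hypothesis),
`AncientKernel` (hypothesis), tree `Negative.rss_apply`, `Negative.typeIBound_rss`, `Negative.IsCoRotating`,
`PineauVicol2026.rotZ*` (`rotZ_add`, `norm_rotZ`, measure preservation of `rotZ`), `Negative.sc*`; Mathlib
`MeasureTheory.Measure.integral_comp_smul`, `LinearIsometryEquiv.measurePreserving`,
`intervalIntegral.hasDerivAt_integral_of_dominated_loc_of_deriv_le`, `ContDiffOn` of parametric integrals. -/
theorem stub_coRotatingKernel :
    (∀ (ν c₁ c₂ C₁ C₂ : ℝ) (v : ℝ → EuclideanSpace ℝ (Fin 3) → EuclideanSpace ℝ (Fin 3)) (K : ℕ → ℝ → EuclideanSpace ℝ (Fin 3) → ℝ),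
      0 < ν → 0 < c₁ → 0 < c₂ → 0 < C₁ → 0 < C₂ →
      Literature.Analysis.FluidPDE.IsSmoothSpaceTimeOn (Set.Iio 0) v →
      (∀ t ∈ Set.Iio (0:ℝ), Literature.Analysis.FluidPDE.VectorCalculus.IsDivFree (v t)) →
      (∀ a b : ℝ, a < b → b < 0 → ∃ B : ℝ, ∀ t ∈ Set.Icc a b, ∀ x, ‖v t x‖ ≤ B) →
      (∀ n : ℕ, Literature.Analysis.FluidPDE.IsAdaptedBackwardKernel ν v (Set.Ico (-(n:ℝ) - 1) 0) 0 0 (K n) ∧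
        ∀ t ∈ Set.Ico (-(n:ℝ) - 1) (0:ℝ), ∀ x,
          c₁ * ((0:ℝ) - t) ^ (-(3:ℝ) / 2) * Real.exp (-(‖x - (0 : EuclideanSpace ℝ (Fin 3))‖ ^ 2) / (c₂ * ((0:ℝ) - t))) ≤ K n t x ∧
          K n t x ≤ C₁ * ((0:ℝ) - t) ^ (-(3:ℝ) / 2) * Real.exp (-(‖x - (0 : EuclideanSpace ℝ (Fin 3))‖ ^ 2) / (C₂ * ((0:ℝ) - t)))) →
      ∃ (G : ℝ → EuclideanSpace ℝ (Fin 3) → ℝ) (φ : ℕ → ℕ), StrictMono φ ∧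
        Literature.Analysis.FluidPDE.IsAdaptedBackwardKernel ν v (Set.Iio 0) 0 0 G ∧
        (∀ t ∈ Set.Iio (0:ℝ), ∀ x,
          c₁ * ((0:ℝ) - t) ^ (-(3:ℝ) / 2) * Real.exp (-(‖x - (0 : EuclideanSpace ℝ (Fin 3))‖ ^ 2) / (c₂ * ((0:ℝ) - t))) ≤ G t x ∧
          G t x ≤ C₁ * ((0:ℝ) - t) ^ (-(3:ℝ) / 2) * Real.exp (-(‖x - (0 : EuclideanSpace ℝ (Fin 3))‖ ^ 2) / (C₂ * ((0:ℝ) - t)))) ∧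
        (∀ t ∈ Set.Iio (0:ℝ), ∀ x,
          Filter.Tendsto (fun n => K (φ n) t x) Filter.atTop (nhds (G t x)))) →
    (∀ (ν C : ℝ), 0 < ν → 0 ≤ C → ∃ c₁ c₂ C₁ C₂ : ℝ, 0 < c₁ ∧ 0 < c₂ ∧ 0 < C₁ ∧ 0 < C₂ ∧
      ∀ (v : ℝ → EuclideanSpace ℝ (Fin 3) → EuclideanSpace ℝ (Fin 3)),
        Literature.Analysis.FluidPDE.IsSmoothSpaceTimeOn (Set.Iio 0) v →
        (∀ t ∈ Set.Iio (0:ℝ), Literature.Analysis.FluidPDE.VectorCalculus.IsDivFree (v t)) →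
        Literature.Analysis.FluidPDE.HasTypeITimeDecay C v →
        ∃ G : ℝ → EuclideanSpace ℝ (Fin 3) → ℝ, Literature.Analysis.FluidPDE.IsAdaptedBackwardKernel ν v (Set.Iio 0) 0 0 G ∧
          ∀ t ∈ Set.Iio (0:ℝ), ∀ x,
            c₁ * ((0:ℝ) - t) ^ (-(3:ℝ) / 2) * Real.exp (-(‖x - (0 : EuclideanSpace ℝ (Fin 3))‖ ^ 2) / (c₂ * ((0:ℝ) - t))) ≤ G t x ∧
            G t x ≤ C₁ * ((0:ℝ) - t) ^ (-(3:ℝ) / 2) * Real.exp (-(‖x - (0 : EuclideanSpace ℝ (Fin 3))‖ ^ 2) / (C₂ * ((0:ℝ) - t)))) →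
    ∀ α : ℝ, Negative.CoRotatingKernelHypothesis α := by
  sorry

/-- **S7 `stub_flatRigidity` (TERMINAL; held by the lead; OPEN — crux-equivalent given S1a–S3).**  A flat
inhabitant `(ν, C, A, C', w, π, K)` in normal form (bound block), obeying the head law of S2, whose kernel is NOT
self-similar about the pole and whose velocity is NOT backward self-similar about the pole, does not exist.
What it contains (certified in this file): by `stub_flatRigidity_wall` below, together with S1a–S5 it implies
`RSSLiouvilleBounded α` for every `α` — bounded-gradient backward rotated-self-similar Liouville, i.e.
Pineau–Vicol 2026 Conj. 1.1 on its open window `α ≈ 1` (an RSS flow with `α ≠ 0`, non-axisymmetric profile and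
its co-rotating kernel is a normal-form flat inhabitant whose kernel and velocity are both non-self-similar).
Known dispatchable sub-cases (not separated as stubs): small Type-I constant `C < ε₀√ν` (Duhamel gap); small
dimensionless strain `sup (−t)‖∇w‖ < 1` (first variation: `2A(−t)^{−3} = H′ ≤ 2 sup((−t)‖∇w‖)(−t)^{−1}H`
forces `sup (−t)‖∇w(t,x)‖ ≥ 1` on any flat inhabitant); `|α| ≪ 1` RSS via the rotation-gauged head
(`Ideator1TorqueProof.lean`: `∫‖Ω − αe₃‖²𝒦 = α²` ⇒ `A ≤ 4α²`) plus an enstrophy gap.  A counterexample to this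
stub is a counterexample to the crux.  Leans on: everything above; PineauVicol2026 (arXiv:2607.09619) Conj. 1.1
/ Thm 1.4 (`pineauVicol2026_rss_liouville`, insufficient: decaying class, extreme `α` only); BradshawTsai2017CPDE
OP 5.1/5.2; ChaeWolf2017RemovingDSS Thm 1.3. -/
theorem stub_flatRigidity :
    ∀ (ν C A M : ℝ) (N : ℕ) (C' : ℕ → ℝ) (w : ℝ → EuclideanSpace ℝ (Fin 3) → EuclideanSpace ℝ (Fin 3)) (π : ℝ → EuclideanSpace ℝ (Fin 3) → ℝ)
      (K : ℝ → EuclideanSpace ℝ (Fin 3) → ℝ),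
      Summit.NavierStokesRegularity.NavierStokesRegularity.Theorems.FrequencyRigidity.Negative.TwoEndedPinning.IsFlatInhabitant ν C A C' w π K →
      (∀ t < 0, ∀ x,
        ‖Literature.Analysis.FluidPDE.curl (w t) x‖ ≤ M / (-t) ∧
        Real.sqrt (-t) * ‖w t x‖ + (-t) * ‖fderiv ℝ (w t) x‖ +
            (-t) * Real.sqrt (-t) * (‖iteratedFDeriv ℝ 2 (w t) x‖ +
              ‖Literature.Analysis.FluidPDE.timeDerivWithin (Set.Iio 0) w t x‖) +
            (-t) * |π t x| + (-t) * Real.sqrt (-t) * ‖fderiv ℝ (π t) x‖ +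
            (-t) ^ 2 * |Literature.Analysis.FluidPDE.timeDerivWithin (Set.Iio 0) π t x|
          ≤ M * (1 + ‖x‖ / Real.sqrt (-t)) ^ N) →
      (∀ t < 0, HasDerivAt (fun τ => ∫ x, (2⁻¹ * ‖w τ x‖ ^ 2 + π τ x) * K τ x)
        (-ν * Literature.Analysis.FluidPDE.adaptedEnstrophy w K t +
          ∫ x, Literature.Analysis.FluidPDE.timeDerivWithin (Set.Iio 0) π t x * K t x) t) →
      ¬ (∃ 𝒦 : EuclideanSpace ℝ (Fin 3) → ℝ, ∀ t < 0, ∀ x, K t x = (Real.sqrt (-t))⁻¹ ^ 3 * 𝒦 ((Real.sqrt (-t))⁻¹ • x)) →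
      ¬ (∃ U : EuclideanSpace ℝ (Fin 3) → EuclideanSpace ℝ (Fin 3), ∀ t < 0, w t = Literature.Analysis.FluidPDE.lerayBackward (1 / 2) 0 U t) →
      False := by
  sorry

/-! ## Proved glue: ancient kernels from compactness + the landed `linearTypeIDriftKernel` -/

/-- **Every Type-I smooth divergence-free drift on `(−∞,0)` carries an adapted Gaussian-comparable kernel at
`(0,0)`, with constants depending on `(ν, C)` only** — from kernel compactness (S4) and the landed linear
theorem `linearTypeIDriftKernel` of crux AdaptedKernelExists (kernels on the windows `[−n−1, 0)` with uniform
two-sided Gaussian bounds; S4 passes to the limit `n → ∞`). -/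
theorem ancientKernel_of_compactness (hKC : KernelCompactness) : AncientKernel := by
  intro ν C hν hC
  obtain ⟨c₁, c₂, C₁, C₂, hc₁, hc₂, hC₁, hC₂, hwin⟩ := linearTypeIDriftKernel ν C hν hC
  refine ⟨c₁, c₂, C₁, C₂, hc₁, hc₂, hC₁, hC₂, fun v hsm hdiv hTI => ?_⟩
  -- kernels on the windows `Ico (−n−1) 0`
  have hK : ∀ n : ℕ, ∃ Kn : ℝ → ℝ³ → ℝ,
      IsAdaptedBackwardKernel ν v (Ico (-(n:ℝ) - 1) 0) 0 0 Kn ∧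
      (∀ t ∈ Ico (-(n:ℝ) - 1) (0:ℝ), ∀ x,
        c₁ * ((0:ℝ) - t) ^ (-(3:ℝ) / 2) * Real.exp (-(‖x - (0 : ℝ³)‖ ^ 2) / (c₂ * ((0:ℝ) - t))) ≤ Kn t x ∧
        Kn t x ≤ C₁ * ((0:ℝ) - t) ^ (-(3:ℝ) / 2) * Real.exp (-(‖x - (0 : ℝ³)‖ ^ 2) / (C₂ * ((0:ℝ) - t)))) := by
    intro n
    have htb : (-(n:ℝ) - 2) < (-(n:ℝ) - 1) := by linarith
    have ht₀ : (-(n:ℝ) - 1) < (0:ℝ) := by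
      have : (0:ℝ) ≤ n := Nat.cast_nonneg n
      linarith
    have hsub : Ico (-(n:ℝ) - 2) (0:ℝ) ⊆ Iio 0 := fun t ht => ht.2
    have hsm' : IsSmoothSpaceTimeOn (Ico (-(n:ℝ) - 2) 0) v := hsm.mono hsub
    have hdiv' : ∀ t ∈ Ico (-(n:ℝ) - 2) (0:ℝ), VectorCalculus.IsDivFree (v t) :=
      fun t ht => hdiv t (hsub ht)
    have hrate : ∀ t ∈ Ico (-(n:ℝ) - 2) (0:ℝ), ∀ x, ‖v t x‖ ≤ C / Real.sqrt (0 - t) := by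
      intro t ht x
      have := hTI t ht.2 x
      simpa using this
    obtain ⟨G, hG, hlo, hhi⟩ := hwin (-(n:ℝ) - 2) (-(n:ℝ) - 1) 0 v 0 htb ht₀ hsm' hdiv' hrate
    exact ⟨G, hG, fun t ht x => ⟨hlo t ht x, hhi t ht x⟩⟩
  choose K hK using hK
  have hloc : ∀ a b : ℝ, a < b → b < 0 → ∃ B : ℝ, ∀ t ∈ Icc a b, ∀ x, ‖v t x‖ ≤ B := by
    intro a b hab hb
    refine ⟨C / Real.sqrt (-b), fun t ht x => (hTI t (lt_of_le_of_lt ht.2 hb) x).trans ?_⟩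
    have hC0 : 0 ≤ C := hC
    exact div_le_div_of_nonneg_left hC0 (Real.sqrt_pos.2 (by linarith))
      (Real.sqrt_le_sqrt (by linarith [ht.2]))
  obtain ⟨G, φ, -, hG, hGb, -⟩ :=
    hKC ν c₁ c₂ C₁ C₂ v K hν hc₁ hc₂ hC₁ hC₂ hsm hdiv hloc (fun n => hK n)
  exact ⟨G, hG, hGb⟩

/-! ## Composition (no `sorry` below this line) -/

/-- Readable alias of the crux. -/
def Crux : Prop :=
  Summit.NavierStokesRegularity.NavierStokesRegularity.Theses.AdaptedFrequency.FrequencyRigidity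

/-- **No flat inhabitant**, from the registered stubs S1a, S1b, S2, S3, S7: normal form by S1a+S1b; a
self-similar kernel is excluded by S3, a self-similar velocity by the landed Tsai leaf
(`TwoEndedPinning.stub_flatEnstrophyLiouville_selfSimilar`), everything else by the head law S2 and the
terminal stub S7. -/
theorem noFlatInhabitant :
    ∀ (ν C A : ℝ) (C' : ℕ → ℝ) (v : ℝ → ℝ³ → ℝ³) (q : ℝ → ℝ³ → ℝ) (K : ℝ → ℝ³ → ℝ),
      ¬ IsFlatInhabitant ν C A C' v q K := by
  intro ν C A C' v q K hFI
  obtain ⟨hν, hNS, hTI, hB, hK, hG, hA, hflat, hFV⟩ := hFI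
  obtain ⟨C₂, M, N, a, p, ha, habd, hNS', hTI', hbd'⟩ := stub_mildFrameBounds ν C v q hν hNS hTI
  obtain ⟨M', N', hFI', hNF⟩ := stub_normalFormTransport ν C A C₂ M N C' v q K a p
    ⟨hν, hNS, hTI, hB, hK, hG, hA, hflat, hFV⟩ ⟨ha, habd, hNS', hTI', hbd'⟩
  set w : ℝ → ℝ³ → ℝ³ := fun t x => v t (x + a t) - deriv a t with hw
  set K' : ℝ → ℝ³ → ℝ := fun t x => K t (x + a t) with hK'
  by_cases hss : (∃ 𝒦 : EuclideanSpace ℝ (Fin 3) → ℝ, ∀ t < 0, ∀ x, K' t x = (Real.sqrt (-t))⁻¹ ^ 3 * 𝒦 ((Real.sqrt (-t))⁻¹ • x))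
  · exact stub_steadyKernelLeaf ν C₂ A M' N' C' w p K' hFI' hNF hss
  by_cases hsv : (∃ U : EuclideanSpace ℝ (Fin 3) → EuclideanSpace ℝ (Fin 3), ∀ t < 0, w t = Literature.Analysis.FluidPDE.lerayBackward (1 / 2) 0 U t)
  · obtain ⟨U, hU⟩ := hsv
    exact TwoEndedPinning.stub_flatEnstrophyLiouville_selfSimilar ν C₂ A C' w p K' U hFI' hU
  obtain ⟨hν', hNSw, hTIw, hBw, hKw, hGw, hA', hflatw, hFVw⟩ := hFI'
  have hHL := stub_movingAdjointBernoulli ν M' N' w p K' hν' hNSw hKw hGw hNF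
  exact stub_flatRigidity ν C₂ A M' N' C' w p K' ⟨hν', hNSw, hTIw, hBw, hKw, hGw, hA', hflatw, hFVw⟩
    hNF hHL hss hsv

/-- THE SKELETON: the crux `AdaptedFrequency.FrequencyRigidity` BY NAME, as a closed term over the registered
stubs through the landed flat reduction (sorries only inside `stub_*`). -/
theorem FrequencyRigidity_of :
    Summit.NavierStokesRegularity.NavierStokesRegularity.Theses.AdaptedFrequency.FrequencyRigidity :=
  TwoEndedPinning.frequencyRigidity_of_flatEnstrophyLiouville
    (fun ν C A C' v q K h => noFlatInhabitant ν C A C' v q K h)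

/-! ## The wall, unconditional modulo S4–S5 -/

/-- **THE WALL, UNCONDITIONAL (modulo S4, S5):** the crux implies bounded-gradient backward RSS-Liouville for
EVERY rotation speed `α` — the disprover's `rssLiouvilleBounded_of_frequencyRigidity` with its hypothesis H(α)
discharged by `stub_coRotatingKernel`. -/
theorem rssLiouville_of_FrequencyRigidity (h : Crux) (α : ℝ) : Negative.RSSLiouvilleBounded α :=
  Negative.rssLiouvilleBounded_of_frequencyRigidity
    (stub_coRotatingKernel stub_kernelCompactness (ancientKernel_of_compactness stub_kernelCompactness) α) h

/-- **What the terminal stub contains:** with S1a–S5, `stub_flatRigidity` implies RSS-Liouville for every `α`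
(through the crux). -/
theorem stub_flatRigidity_wall (α : ℝ) : Negative.RSSLiouvilleBounded α :=
  rssLiouville_of_FrequencyRigidity FrequencyRigidity_of α

end Summit.NavierStokesRegularity.NavierStokesRegularity.Cruxes.FrequencyRigidity.MovingAdjointBernoulli

end
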